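import Literature.Analysis.FluidPDE.HouLeiLiEstimate
import HarnessLib

/-!
# Wei 2016, §3: the integration by parts behind `∫ J (ω_r∂ᵣ + ω_z∂_z)(u_r/r) ≤ ‖∇J‖ ‖u_θ ∇(u_r/r)‖`

Analysis/FluidPDE proof file (theorems only; no definitions, no named facts) on the way to
`Literature.Analysis.FluidPDE.Wei2016_logModulus_regularity`
(`LeiZhang2017AxisymmetricCriteria.lean`), after

* D. Wei, *Regularity criterion to the axially symmetric Navier–Stokes equations*, J. Math.
  Anal. Appl. 435 (2016) 402–413 = arXiv:1508.03318, §3, between (3.2) and (3.3):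
  "`∫ J(ω_r∂ᵣ + ω_z∂_z)(u_r/r) dx = ∫ [∇×(u_θe_θ)]·(J∇(u_r/r)) dx = ∫ u_θe_θ·(∇J × ∇(u_r/r)) dx
  ≤ ½‖∇J‖²_{L²} + ½‖u_θ ∇(u_r/r)‖²_{L²}`" (also Lei–Zhang 2017, §3, (E2)).

In the smooth Hou–Li variables `Φ = u_θ/r`, `W = u_r/r` (so `J = −∂_zΦ`, `u_θ e_θ = Φ · Jx`) the
source term of the `J`-equation is, pointwise (sibling file, from `div u = 0` and axisymmetry),
`S = ∂_zW · DΦ[x_h] + J · DW[x_h] + 2 ∂_zW · Φ` (`x_h = (x₀, x₁, 0)`, `D(·)[x_h] = r∂ᵣ`), and the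
displayed chain is the following PDE-free statement about two functions `Φ, W ∈ C³(ℝ³)`, proved
here by two whole-space integrations by parts (one in `z`, one in the horizontal directions) and a
pointwise Cauchy–Schwarz/Young inequality:

* `Wei2016.integral_dz_mul_jSource_eq` — with `Z = ∂_zΦ` (`= −J`):
  `∫ Z (∂_zW · DΦ[x_h] − Z · DW[x_h] + 2 ∂_zW Φ) = ∫ Φ (∂_zZ · DW[x_h] − ∂_zW · DZ[x_h])`
  (the right side is `∫ u_θ e_θ · (∇J × ∇W)` written out: `Φ · DW[x_h] = u_θ ∂ᵣW`, …);
* `Wei2016.mul_cross_le` — pointwise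
  `Φ (∂_zZ · DW[x_h] − ∂_zW · DZ[x_h]) ≤ ½ |∇Z|² + ½ (x₀² + x₁²) Φ² |∇W|²`
  (`(x₀² + x₁²) Φ² = u_θ²`);
* `Wei2016.integral_dz_mul_jSource_le` — hence
  `∫ Z·S₀ ≤ ½ ∫ |∇Z|² + ½ ∫ r²Φ² |∇W|²`, `S₀ = ∂_zW · DΦ[x_h] − Z · DW[x_h] + 2 ∂_zW Φ`
  (with `J = −Z` one has `J · S = Z · S₀` for `S = ∂_zW · DΦ[x_h] + J · DW[x_h] + 2 ∂_zW Φ`, so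
  this is `∫ J S ≤ ½‖∇J‖² + ½‖u_θ∇W‖²`).

All gradients are written as sums of squares of the three partial derivatives, all integrals are
over `ℝ³`, and the standing hypotheses are smoothness (`Φ, W ∈ C³`) and membership in `L²`/`L^∞`
of the finitely many functions that are paired; whole-space integration by parts is Mathlib's
`integral_mul_fderiv_eq_neg_fderiv_mul_of_integrable` (integrable data, no decay needed).

## References

* D. Wei, arXiv:1508.03318, §3 (the estimate of `∫ J(ω_r∂ᵣ + ω_z∂_z)(u_r/r)`). [Wei2016]
* Z. Lei, Q. S. Zhang, arXiv:1505.02628, §3, (E2). [LeiZhang2017]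
-/

noncomputable section

open MeasureTheory Set Function Filter Topology
open scoped ENNReal

namespace Literature.Analysis.FluidPDE

namespace Wei2016

variable {Φ W : EuclideanSpace ℝ (Fin 3) → ℝ}

/-! ### Integrability of products -/

/-- `a b c ∈ L¹` when `a ∈ L^∞` and `b, c ∈ L²`. [folklore] -/
theorem integrable_mul_mul_of_top_two_two {a b c : EuclideanSpace ℝ (Fin 3) → ℝ}
    (ha : MemLp a ∞ volume) (hb : MemLp b 2 volume) (hc : MemLp c 2 volume) :
    Integrable fun x => a x * b x * c x := by
  have h := (hb.integrable_mul hc).mul_of_top_right ha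
  refine h.congr (Eventually.of_forall fun x => ?_)
  simp only [Pi.mul_apply]
  ring

/-- `a b c ∈ L¹` when `a, b ∈ L²` and `c ∈ L^∞`. [folklore] -/
theorem integrable_mul_mul_of_two_two_top {a b c : EuclideanSpace ℝ (Fin 3) → ℝ}
    (ha : MemLp a 2 volume) (hb : MemLp b 2 volume) (hc : MemLp c ∞ volume) :
    Integrable fun x => a x * b x * c x := by
  have h := (ha.integrable_mul hb).mul_of_top_left hc
  refine h.congr (Eventually.of_forall fun x => ?_)
  simp only [Pi.mul_apply]

/-! ### Calculus of the two products that are integrated by parts -/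

/-- The coordinate functions are differentiable with derivative the coordinate projections.
[folklore] -/
theorem hasFDerivAt_coord (i : Fin 3) (x : EuclideanSpace ℝ (Fin 3)) :
    HasFDerivAt (fun y : EuclideanSpace ℝ (Fin 3) => (y i : ℝ))
      (EuclideanSpace.proj (𝕜 := ℝ) i : EuclideanSpace ℝ (Fin 3) →L[ℝ] ℝ) x :=
  (EuclideanSpace.proj (𝕜 := ℝ) i).hasFDerivAt

/-- `∂_b (y ↦ yᵢ · g y) = bᵢ g + yᵢ ∂_b g`. [folklore] -/
theorem fderiv_coord_mul_apply {g : EuclideanSpace ℝ (Fin 3) → ℝ} {x : EuclideanSpace ℝ (Fin 3)}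
    (hg : DifferentiableAt ℝ g x) (i : Fin 3) (b : EuclideanSpace ℝ (Fin 3)) :
    fderiv ℝ (fun y : EuclideanSpace ℝ (Fin 3) => y i * g y) x b = b i * g x + x i * fderiv ℝ g x b := by
  rw [((hasFDerivAt_coord i x).fun_mul hg.hasFDerivAt).fderiv]
  simp only [_root_.add_apply, _root_.smul_apply, smul_eq_mul, PiLp.proj_apply]
  ring

/-- The derivative of `y ↦ Φ y · (y₀ W₀ y + y₁ W₁ y)` in a direction `b` with `b₀ = b₁ = 0`
(e.g. `b = e₂`): `∂_bΦ · (x₀W₀ + x₁W₁) + Φ · (x₀ ∂_bW₀ + x₁ ∂_bW₁)`. [folklore] -/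
theorem fderiv_mul_horizontal_apply {W₀ W₁ : EuclideanSpace ℝ (Fin 3) → ℝ}
    {x : EuclideanSpace ℝ (Fin 3)} (hΦ : DifferentiableAt ℝ Φ x) (h0 : DifferentiableAt ℝ W₀ x)
    (h1 : DifferentiableAt ℝ W₁ x) {b : EuclideanSpace ℝ (Fin 3)} (hb0 : b 0 = 0) (hb1 : b 1 = 0) :
    fderiv ℝ (fun y : EuclideanSpace ℝ (Fin 3) => Φ y * (y 0 * W₀ y + y 1 * W₁ y)) x b =
      fderiv ℝ Φ x b * (x 0 * W₀ x + x 1 * W₁ x) +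
        Φ x * (x 0 * fderiv ℝ W₀ x b + x 1 * fderiv ℝ W₁ x b) := by
  have hA : DifferentiableAt ℝ (fun y : EuclideanSpace ℝ (Fin 3) => y 0 * W₀ y) x :=
    (hasFDerivAt_coord 0 x).differentiableAt.mul h0
  have hB : DifferentiableAt ℝ (fun y : EuclideanSpace ℝ (Fin 3) => y 1 * W₁ y) x :=
    (hasFDerivAt_coord 1 x).differentiableAt.mul h1
  have hAB : DifferentiableAt ℝ (fun y : EuclideanSpace ℝ (Fin 3) => y 0 * W₀ y + y 1 * W₁ y) x :=
    hA.add hB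
  rw [fderiv_fun_mul hΦ hAB]
  simp only [_root_.add_apply, _root_.smul_apply, smul_eq_mul]
  rw [fderiv_fun_add hA hB]
  simp only [_root_.add_apply]
  rw [fderiv_coord_mul_apply h0, fderiv_coord_mul_apply h1, hb0, hb1]
  ring

/-- The derivative of `y ↦ Φ y · G y · yᵢ` in the direction `eᵢ`:
`∂ᵢΦ · G · xᵢ + Φ · ∂ᵢG · xᵢ + Φ · G`. [folklore] -/
theorem fderiv_mul_mul_coord_apply {G : EuclideanSpace ℝ (Fin 3) → ℝ} {x : EuclideanSpace ℝ (Fin 3)}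
    (hΦ : DifferentiableAt ℝ Φ x) (hG : DifferentiableAt ℝ G x) (i : Fin 3) :
    fderiv ℝ (fun y : EuclideanSpace ℝ (Fin 3) => Φ y * G y * y i) x (EuclideanSpace.single i 1) =
      fderiv ℝ Φ x (EuclideanSpace.single i 1) * G x * x i +
        Φ x * fderiv ℝ G x (EuclideanSpace.single i 1) * x i + Φ x * G x := by
  have hΦG : DifferentiableAt ℝ (fun y : EuclideanSpace ℝ (Fin 3) => Φ y * G y) x := hΦ.mul hG
  rw [fderiv_fun_mul hΦG (hasFDerivAt_coord i x).differentiableAt]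
  simp only [_root_.add_apply, _root_.smul_apply, smul_eq_mul]
  rw [fderiv_fun_mul hΦ hG, (hasFDerivAt_coord i x).fderiv]
  simp only [_root_.add_apply, _root_.smul_apply, smul_eq_mul, PiLp.proj_apply,
    PiLp.single_apply, if_true]
  ring

/-! ### The integration by parts -/

/-- **`∫ J S = ∫ u_θ e_θ · (∇J × ∇W)`, written out.** For `Φ, W ∈ C³(ℝ³)` put `Z = ∂₂Φ`,
`Zz = ∂₂Z`, `Zᵢ = ∂ᵢZ`, `Φᵢ = ∂ᵢΦ`, `Wz = ∂₂W`, `Wᵢ = ∂ᵢW`, `Wzᵢ = ∂ᵢWz` (`i = 0, 1`). If the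
paired functions are in `L²`/`L^∞` as listed, then
`∫ Z (Wz (x₀Φ₀ + x₁Φ₁) − Z (x₀W₀ + x₁W₁) + 2 Wz Φ) = ∫ Φ (Zz (x₀W₀ + x₁W₁) − Wz (x₀Z₀ + x₁Z₁))`.
Proof: integrate `Φ (x₀W₀ + x₁W₁) · ∂₂Z` by parts in `x₂` and `Φ Wz xᵢ · ∂ᵢZ` by parts in `xᵢ`
(`i = 0, 1`); the terms `± Φ Z (x₀Wz₀ + x₁Wz₁)` cancel (`∂₂Wᵢ = ∂ᵢWz`). With `J = −Z`, `u_θ/r = Φ`,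
`u_r/r = W` this is Wei's `∫ J (ω_r∂ᵣ + ω_z∂_z)(u_r/r) = ∫ u_θ e_θ · (∇J × ∇(u_r/r))`.
[cite: Wei2016, §3 (the estimate of the source term of (3.1))] -/
theorem integral_dz_mul_jSource_eq (hΦ : ContDiff ℝ 3 Φ) (hW : ContDiff ℝ 3 W)
    {Z Zz Z₀ Z₁ Φ₀ Φ₁ Wz W₀ W₁ Wz₀ Wz₁ : EuclideanSpace ℝ (Fin 3) → ℝ}
    (hZ : Z = fun x => fderiv ℝ Φ x (EuclideanSpace.single 2 1))
    (hZz : Zz = fun x => fderiv ℝ Z x (EuclideanSpace.single 2 1))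
    (hZ₀ : Z₀ = fun x => fderiv ℝ Z x (EuclideanSpace.single 0 1))
    (hZ₁ : Z₁ = fun x => fderiv ℝ Z x (EuclideanSpace.single 1 1))
    (hΦ₀ : Φ₀ = fun x => fderiv ℝ Φ x (EuclideanSpace.single 0 1))
    (hΦ₁ : Φ₁ = fun x => fderiv ℝ Φ x (EuclideanSpace.single 1 1))
    (hWz : Wz = fun x => fderiv ℝ W x (EuclideanSpace.single 2 1))
    (hW₀ : W₀ = fun x => fderiv ℝ W x (EuclideanSpace.single 0 1))
    (hW₁ : W₁ = fun x => fderiv ℝ W x (EuclideanSpace.single 1 1))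
    (hWz₀ : Wz₀ = fun x => fderiv ℝ Wz x (EuclideanSpace.single 0 1))
    (hWz₁ : Wz₁ = fun x => fderiv ℝ Wz x (EuclideanSpace.single 1 1))
    (iΦ : MemLp Φ ∞ volume) (iZ2 : MemLp Z 2 volume) (iZt : MemLp Z ∞ volume)
    (iZz : MemLp Zz 2 volume) (iWz : MemLp Wz 2 volume)
    (ixW₀ : MemLp (fun x => x 0 * W₀ x) 2 volume) (ixW₁ : MemLp (fun x => x 1 * W₁ x) 2 volume)
    (ixWz₀ : MemLp (fun x => x 0 * Wz₀ x) 2 volume) (ixWz₁ : MemLp (fun x => x 1 * Wz₁ x) 2 volume)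
    (ixΦ₀ : MemLp (fun x => x 0 * Φ₀ x) 2 volume) (ixΦ₁ : MemLp (fun x => x 1 * Φ₁ x) 2 volume)
    (ixZ₀ : MemLp (fun x => x 0 * Z₀ x) 2 volume) (ixZ₁ : MemLp (fun x => x 1 * Z₁ x) 2 volume)
    (ix0Φ : MemLp (fun x => x 0 * Φ x) ∞ volume) (ix1Φ : MemLp (fun x => x 1 * Φ x) ∞ volume) :
    ∫ x, Z x * (Wz x * (x 0 * Φ₀ x + x 1 * Φ₁ x) - Z x * (x 0 * W₀ x + x 1 * W₁ x) +
        2 * Wz x * Φ x) =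
      ∫ x, Φ x * (Zz x * (x 0 * W₀ x + x 1 * W₁ x) - Wz x * (x 0 * Z₀ x + x 1 * Z₁ x)) := by
  -- smoothness of the pieces
  have hΦd : Differentiable ℝ Φ := hΦ.differentiable (by norm_num)
  have hW2 : ContDiff ℝ 2 W := hW.of_le (by norm_num)
  have hZc : ContDiff ℝ 2 Z := by
    rw [hZ]; exact contDiff_fderiv_apply_const_succ (n := 2) (by exact_mod_cast hΦ) _
  have hZd : Differentiable ℝ Z := hZc.differentiable two_ne_zero
  have hWzc : ContDiff ℝ 2 Wz := by
    rw [hWz]; exact contDiff_fderiv_apply_const_succ (n := 2) (by exact_mod_cast hW) _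
  have hWzd : Differentiable ℝ Wz := hWzc.differentiable two_ne_zero
  have hW₀d : Differentiable ℝ W₀ := by
    rw [hW₀]
    exact (contDiff_fderiv_apply_const_succ (n := 2) (by exact_mod_cast hW) _).differentiable
      two_ne_zero
  have hW₁d : Differentiable ℝ W₁ := by
    rw [hW₁]
    exact (contDiff_fderiv_apply_const_succ (n := 2) (by exact_mod_cast hW) _).differentiable
      two_ne_zero
  -- pointwise unfoldings
  have eZ : ∀ x, fderiv ℝ Φ x (EuclideanSpace.single 2 1) = Z x := fun x => by rw [hZ]
  have eZz : ∀ x, fderiv ℝ Z x (EuclideanSpace.single 2 1) = Zz x := fun x => by rw [hZz]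
  have eZ₀ : ∀ x, fderiv ℝ Z x (EuclideanSpace.single 0 1) = Z₀ x := fun x => by rw [hZ₀]
  have eZ₁ : ∀ x, fderiv ℝ Z x (EuclideanSpace.single 1 1) = Z₁ x := fun x => by rw [hZ₁]
  have eΦ₀ : ∀ x, fderiv ℝ Φ x (EuclideanSpace.single 0 1) = Φ₀ x := fun x => by rw [hΦ₀]
  have eΦ₁ : ∀ x, fderiv ℝ Φ x (EuclideanSpace.single 1 1) = Φ₁ x := fun x => by rw [hΦ₁]
  have eWz₀ : ∀ x, fderiv ℝ Wz x (EuclideanSpace.single 0 1) = Wz₀ x := fun x => by rw [hWz₀]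
  have eWz₁ : ∀ x, fderiv ℝ Wz x (EuclideanSpace.single 1 1) = Wz₁ x := fun x => by rw [hWz₁]
  -- `∂₂W₀ = ∂₀Wz`, `∂₂W₁ = ∂₁Wz`
  have eW₀z : ∀ x, fderiv ℝ W₀ x (EuclideanSpace.single 2 1) = Wz₀ x := fun x => by
    rw [hW₀, fderiv_fderiv_apply_comm_vec_scalar hW2 x, ← eWz₀ x, hWz]
  have eW₁z : ∀ x, fderiv ℝ W₁ x (EuclideanSpace.single 2 1) = Wz₁ x := fun x => by
    rw [hW₁, fderiv_fderiv_apply_comm_vec_scalar hW2 x, ← eWz₁ x, hWz]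
  -- the three products and their derivatives
  set f₂ : EuclideanSpace ℝ (Fin 3) → ℝ := fun x => Φ x * (x 0 * W₀ x + x 1 * W₁ x) with hf₂
  set f₀ : EuclideanSpace ℝ (Fin 3) → ℝ := fun x => Φ x * Wz x * x 0 with hf₀
  set f₁ : EuclideanSpace ℝ (Fin 3) → ℝ := fun x => Φ x * Wz x * x 1 with hf₁
  have hf₂d : Differentiable ℝ f₂ := fun x =>
    (hΦd x).mul (((hasFDerivAt_coord 0 x).differentiableAt.mul (hW₀d x)).add
      ((hasFDerivAt_coord 1 x).differentiableAt.mul (hW₁d x)))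
  have hf₀d : Differentiable ℝ f₀ := fun x =>
    ((hΦd x).mul (hWzd x)).mul (hasFDerivAt_coord 0 x).differentiableAt
  have hf₁d : Differentiable ℝ f₁ := fun x =>
    ((hΦd x).mul (hWzd x)).mul (hasFDerivAt_coord 1 x).differentiableAt
  have df₂ : ∀ x, fderiv ℝ f₂ x (EuclideanSpace.single 2 1) =
      Z x * (x 0 * W₀ x + x 1 * W₁ x) + Φ x * (x 0 * Wz₀ x + x 1 * Wz₁ x) := fun x => by
    rw [hf₂, fderiv_mul_horizontal_apply (hΦd x) (hW₀d x) (hW₁d x) (by simp) (by simp), eZ,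
      eW₀z, eW₁z]
  have df₀ : ∀ x, fderiv ℝ f₀ x (EuclideanSpace.single 0 1) =
      Φ₀ x * Wz x * x 0 + Φ x * Wz₀ x * x 0 + Φ x * Wz x := fun x => by
    rw [hf₀, fderiv_mul_mul_coord_apply (hΦd x) (hWzd x) 0, eΦ₀, eWz₀]
  have df₁ : ∀ x, fderiv ℝ f₁ x (EuclideanSpace.single 1 1) =
      Φ₁ x * Wz x * x 1 + Φ x * Wz₁ x * x 1 + Φ x * Wz x := fun x => by
    rw [hf₁, fderiv_mul_mul_coord_apply (hΦd x) (hWzd x) 1, eΦ₁, eWz₁]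
  -- integrability of all products that occur
  have I1 : Integrable fun x => (Z x * (x 0 * W₀ x + x 1 * W₁ x) +
      Φ x * (x 0 * Wz₀ x + x 1 * Wz₁ x)) * Z x := by
    have h := ((integrable_mul_mul_of_top_two_two iZt ixW₀ iZ2).add
      (integrable_mul_mul_of_top_two_two iZt ixW₁ iZ2)).add
      ((integrable_mul_mul_of_top_two_two iΦ ixWz₀ iZ2).add
      (integrable_mul_mul_of_top_two_two iΦ ixWz₁ iZ2))
    refine h.congr (Eventually.of_forall fun x => ?_)
    simp only [Pi.add_apply]
    ring
  have I2 : Integrable fun x => f₂ x * Zz x := by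
    have h := (integrable_mul_mul_of_top_two_two iΦ ixW₀ iZz).add
      (integrable_mul_mul_of_top_two_two iΦ ixW₁ iZz)
    refine h.congr (Eventually.of_forall fun x => ?_)
    simp only [Pi.add_apply, hf₂]
    ring
  have I3 : Integrable fun x => f₂ x * Z x := by
    have h := (integrable_mul_mul_of_top_two_two iΦ ixW₀ iZ2).add
      (integrable_mul_mul_of_top_two_two iΦ ixW₁ iZ2)
    refine h.congr (Eventually.of_forall fun x => ?_)
    simp only [Pi.add_apply, hf₂]
    ring
  have I4 : Integrable fun x => (Φ₀ x * Wz x * x 0 + Φ x * Wz₀ x * x 0 + Φ x * Wz x) * Z x := by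
    have h := ((integrable_mul_mul_of_two_two_top ixΦ₀ iWz iZt).add
      (integrable_mul_mul_of_top_two_two iΦ ixWz₀ iZ2)).add
      (integrable_mul_mul_of_top_two_two iΦ iWz iZ2)
    refine h.congr (Eventually.of_forall fun x => ?_)
    simp only [Pi.add_apply]
    ring
  have I5 : Integrable fun x => f₀ x * Z₀ x := by
    refine (integrable_mul_mul_of_top_two_two iΦ iWz ixZ₀).congr
      (Eventually.of_forall fun x => ?_)
    simp only [hf₀]
    ring
  have I6 : Integrable fun x => f₀ x * Z x := by
    refine (integrable_mul_mul_of_top_two_two ix0Φ iWz iZ2).congr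
      (Eventually.of_forall fun x => ?_)
    simp only [hf₀]
    ring
  have I7 : Integrable fun x => (Φ₁ x * Wz x * x 1 + Φ x * Wz₁ x * x 1 + Φ x * Wz x) * Z x := by
    have h := ((integrable_mul_mul_of_two_two_top ixΦ₁ iWz iZt).add
      (integrable_mul_mul_of_top_two_two iΦ ixWz₁ iZ2)).add
      (integrable_mul_mul_of_top_two_two iΦ iWz iZ2)
    refine h.congr (Eventually.of_forall fun x => ?_)
    simp only [Pi.add_apply]
    ring
  have I8 : Integrable fun x => f₁ x * Z₁ x := by
    refine (integrable_mul_mul_of_top_two_two iΦ iWz ixZ₁).congr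
      (Eventually.of_forall fun x => ?_)
    simp only [hf₁]
    ring
  have I9 : Integrable fun x => f₁ x * Z x := by
    refine (integrable_mul_mul_of_top_two_two ix1Φ iWz iZ2).congr
      (Eventually.of_forall fun x => ?_)
    simp only [hf₁]
    ring
  -- the three integrations by parts
  have A : ∫ x, f₂ x * Zz x = -∫ x, (Z x * (x 0 * W₀ x + x 1 * W₁ x) +
      Φ x * (x 0 * Wz₀ x + x 1 * Wz₁ x)) * Z x := by
    have h := integral_mul_fderiv_eq_neg_of_differentiable hf₂d hZd (EuclideanSpace.single 2 1)
      (I1.congr (Eventually.of_forall fun x => by simp only [df₂]))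
      (I2.congr (Eventually.of_forall fun x => by simp only [eZz])) I3
    simp only [eZz, df₂] at h
    exact h
  have B₀ : ∫ x, f₀ x * Z₀ x =
      -∫ x, (Φ₀ x * Wz x * x 0 + Φ x * Wz₀ x * x 0 + Φ x * Wz x) * Z x := by
    have h := integral_mul_fderiv_eq_neg_of_differentiable hf₀d hZd (EuclideanSpace.single 0 1)
      (I4.congr (Eventually.of_forall fun x => by simp only [df₀]))
      (I5.congr (Eventually.of_forall fun x => by simp only [eZ₀])) I6
    simp only [eZ₀, df₀] at h
    exact h
  have B₁ : ∫ x, f₁ x * Z₁ x =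
      -∫ x, (Φ₁ x * Wz x * x 1 + Φ x * Wz₁ x * x 1 + Φ x * Wz x) * Z x := by
    have h := integral_mul_fderiv_eq_neg_of_differentiable hf₁d hZd (EuclideanSpace.single 1 1)
      (I7.congr (Eventually.of_forall fun x => by simp only [df₁]))
      (I8.congr (Eventually.of_forall fun x => by simp only [eZ₁])) I9
    simp only [eZ₁, df₁] at h
    exact h
  -- assemble
  have eR : ∫ x, Φ x * (Zz x * (x 0 * W₀ x + x 1 * W₁ x) - Wz x * (x 0 * Z₀ x + x 1 * Z₁ x)) =
      (∫ x, f₂ x * Zz x) - (∫ x, f₀ x * Z₀ x) - ∫ x, f₁ x * Z₁ x := by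
    have I25 : Integrable fun a => f₂ a * Zz a - f₀ a * Z₀ a := I2.sub I5
    rw [← integral_sub I2 I5, ← integral_sub I25 I8]
    refine integral_congr_ae (Eventually.of_forall fun x => ?_)
    simp only [hf₂, hf₀, hf₁]
    ring
  have I41 : Integrable fun a => (Φ₀ a * Wz a * a 0 + Φ a * Wz₀ a * a 0 + Φ a * Wz a) * Z a -
      (Z a * (a 0 * W₀ a + a 1 * W₁ a) + Φ a * (a 0 * Wz₀ a + a 1 * Wz₁ a)) * Z a := I4.sub I1
  rw [eR, A, B₀, B₁, neg_sub_neg, ← integral_sub I4 I1, sub_neg_eq_add,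
    ← integral_add I41 I7]
  refine integral_congr_ae (Eventually.of_forall fun x => ?_)
  ring

/-! ### The pointwise bound and the estimate -/

/-- **Pointwise Cauchy–Schwarz/Young for the triple product** `u_θ e_θ · (∇J × ∇W)`: for real
numbers, with `P = x₀Φ`, `Q = x₁Φ`,
`Φ (Zz (x₀W₀ + x₁W₁) − Wz (x₀Z₀ + x₁Z₁)) ≤ ½ (Z₀² + Z₁² + Zz²) + ½ (P² + Q²)(W₀² + W₁² + Wz²)`
(twice the difference is `(Zz − PW₀ − QW₁)² + (Z₀ + PWz)² + (Z₁ + QWz)² + (PW₁ − QW₀)²`).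
[folklore] -/
theorem mul_cross_le (Φ Zz Z₀ Z₁ Wz W₀ W₁ x₀ x₁ : ℝ) :
    Φ * (Zz * (x₀ * W₀ + x₁ * W₁) - Wz * (x₀ * Z₀ + x₁ * Z₁)) ≤
      (Z₀ ^ 2 + Z₁ ^ 2 + Zz ^ 2) / 2 +
        ((x₀ * Φ) ^ 2 + (x₁ * Φ) ^ 2) * (W₀ ^ 2 + W₁ ^ 2 + Wz ^ 2) / 2 := by
  nlinarith [sq_nonneg (Zz - x₀ * Φ * W₀ - x₁ * Φ * W₁), sq_nonneg (Z₀ + x₀ * Φ * Wz),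
    sq_nonneg (Z₁ + x₁ * Φ * Wz), sq_nonneg (x₀ * Φ * W₁ - x₁ * Φ * W₀)]

/-- **Wei 2016, §3: `∫ J (ω_r∂ᵣ + ω_z∂_z)(u_r/r) ≤ ½‖∇J‖² + ½‖u_θ∇(u_r/r)‖²`, PDE-free form.**
For `Φ, W ∈ C³(ℝ³)` with the notation and the `L²`/`L^∞` hypotheses of
`integral_dz_mul_jSource_eq`, and with `|∇Z|² = Z₀² + Z₁² + Zz²`,
`r²Φ²|∇W|² = ((x₀Φ)² + (x₁Φ)²)(W₀² + W₁² + Wz²)` integrable: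
`∫ Z (Wz (x₀Φ₀ + x₁Φ₁) − Z (x₀W₀ + x₁W₁) + 2 Wz Φ) ≤ ½ ∫ |∇Z|² + ½ ∫ r²Φ² |∇W|²`.
With `J = −Z = −∂_z(u_θ/r)`, `W = u_r/r`, `rΦ = u_θ` this is the displayed estimate
(`integral_dz_mul_jSource_eq` and the pointwise `mul_cross_le`). [cite: Wei2016, §3 (the estimate of the source term of (3.1))] -/
theorem integral_dz_mul_jSource_le (hΦ : ContDiff ℝ 3 Φ) (hW : ContDiff ℝ 3 W)
    {Z Zz Z₀ Z₁ Φ₀ Φ₁ Wz W₀ W₁ Wz₀ Wz₁ : EuclideanSpace ℝ (Fin 3) → ℝ}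
    (hZ : Z = fun x => fderiv ℝ Φ x (EuclideanSpace.single 2 1))
    (hZz : Zz = fun x => fderiv ℝ Z x (EuclideanSpace.single 2 1))
    (hZ₀ : Z₀ = fun x => fderiv ℝ Z x (EuclideanSpace.single 0 1))
    (hZ₁ : Z₁ = fun x => fderiv ℝ Z x (EuclideanSpace.single 1 1))
    (hΦ₀ : Φ₀ = fun x => fderiv ℝ Φ x (EuclideanSpace.single 0 1))
    (hΦ₁ : Φ₁ = fun x => fderiv ℝ Φ x (EuclideanSpace.single 1 1))
    (hWz : Wz = fun x => fderiv ℝ W x (EuclideanSpace.single 2 1))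
    (hW₀ : W₀ = fun x => fderiv ℝ W x (EuclideanSpace.single 0 1))
    (hW₁ : W₁ = fun x => fderiv ℝ W x (EuclideanSpace.single 1 1))
    (hWz₀ : Wz₀ = fun x => fderiv ℝ Wz x (EuclideanSpace.single 0 1))
    (hWz₁ : Wz₁ = fun x => fderiv ℝ Wz x (EuclideanSpace.single 1 1))
    (iΦ : MemLp Φ ∞ volume) (iZ2 : MemLp Z 2 volume) (iZt : MemLp Z ∞ volume)
    (iZz : MemLp Zz 2 volume) (iWz : MemLp Wz 2 volume)
    (ixW₀ : MemLp (fun x => x 0 * W₀ x) 2 volume) (ixW₁ : MemLp (fun x => x 1 * W₁ x) 2 volume)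
    (ixWz₀ : MemLp (fun x => x 0 * Wz₀ x) 2 volume) (ixWz₁ : MemLp (fun x => x 1 * Wz₁ x) 2 volume)
    (ixΦ₀ : MemLp (fun x => x 0 * Φ₀ x) 2 volume) (ixΦ₁ : MemLp (fun x => x 1 * Φ₁ x) 2 volume)
    (ixZ₀ : MemLp (fun x => x 0 * Z₀ x) 2 volume) (ixZ₁ : MemLp (fun x => x 1 * Z₁ x) 2 volume)
    (ix0Φ : MemLp (fun x => x 0 * Φ x) ∞ volume) (ix1Φ : MemLp (fun x => x 1 * Φ x) ∞ volume)
    (hR₁ : Integrable fun x => Z₀ x ^ 2 + Z₁ x ^ 2 + Zz x ^ 2)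
    (hR₂ : Integrable fun x => ((x 0 * Φ x) ^ 2 + (x 1 * Φ x) ^ 2) *
      (W₀ x ^ 2 + W₁ x ^ 2 + Wz x ^ 2)) :
    ∫ x, Z x * (Wz x * (x 0 * Φ₀ x + x 1 * Φ₁ x) - Z x * (x 0 * W₀ x + x 1 * W₁ x) +
        2 * Wz x * Φ x) ≤
      (1 / 2) * (∫ x, (Z₀ x ^ 2 + Z₁ x ^ 2 + Zz x ^ 2)) +
        (1 / 2) * (∫ x, ((x 0 * Φ x) ^ 2 + (x 1 * Φ x) ^ 2) *
          (W₀ x ^ 2 + W₁ x ^ 2 + Wz x ^ 2)) := by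
  rw [integral_dz_mul_jSource_eq hΦ hW hZ hZz hZ₀ hZ₁ hΦ₀ hΦ₁ hWz hW₀ hW₁ hWz₀ hWz₁ iΦ iZ2 iZt iZz
    iWz ixW₀ ixW₁ ixWz₀ ixWz₁ ixΦ₀ ixΦ₁ ixZ₀ ixZ₁ ix0Φ ix1Φ]
  -- the left integrand is integrable
  have hL : Integrable fun x => Φ x * (Zz x * (x 0 * W₀ x + x 1 * W₁ x) -
      Wz x * (x 0 * Z₀ x + x 1 * Z₁ x)) := by
    have h := ((integrable_mul_mul_of_top_two_two iΦ ixW₀ iZz).add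
      (integrable_mul_mul_of_top_two_two iΦ ixW₁ iZz)).sub
      ((integrable_mul_mul_of_top_two_two iΦ iWz ixZ₀).add
      (integrable_mul_mul_of_top_two_two iΦ iWz ixZ₁))
    refine h.congr (Eventually.of_forall fun x => ?_)
    simp only [Pi.add_apply, Pi.sub_apply]
    ring
  have hA : Integrable fun x => (1 / 2 : ℝ) * (Z₀ x ^ 2 + Z₁ x ^ 2 + Zz x ^ 2) :=
    hR₁.const_mul _
  have hB : Integrable fun x => (1 / 2 : ℝ) * (((x 0 * Φ x) ^ 2 + (x 1 * Φ x) ^ 2) *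
      (W₀ x ^ 2 + W₁ x ^ 2 + Wz x ^ 2)) :=
    hR₂.const_mul _
  calc ∫ x, Φ x * (Zz x * (x 0 * W₀ x + x 1 * W₁ x) - Wz x * (x 0 * Z₀ x + x 1 * Z₁ x))
      ≤ ∫ x, ((1 / 2 : ℝ) * (Z₀ x ^ 2 + Z₁ x ^ 2 + Zz x ^ 2) +
          (1 / 2 : ℝ) * (((x 0 * Φ x) ^ 2 + (x 1 * Φ x) ^ 2) *
            (W₀ x ^ 2 + W₁ x ^ 2 + Wz x ^ 2))) :=
        integral_mono hL (hA.add hB) fun x =>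
          (mul_cross_le _ _ _ _ _ _ _ _ _).trans_eq (by ring)
    _ = (1 / 2) * (∫ x, (Z₀ x ^ 2 + Z₁ x ^ 2 + Zz x ^ 2)) +
        (1 / 2) * (∫ x, ((x 0 * Φ x) ^ 2 + (x 1 * Φ x) ^ 2) *
          (W₀ x ^ 2 + W₁ x ^ 2 + Wz x ^ 2)) := by
        rw [integral_add hA hB, integral_const_mul, integral_const_mul]

end Wei2016

end Literature.Analysis.FluidPDE

end
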